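import Summits.BirchSwinnertonDyer.BirchSwinnertonDyer.Theorems.PrintX10bHeegnerDivisibilityHowardFrames
import Literature.NumberTheory.EllipticCurves.HeegnerPointsOfConductorOneGaloisConjProofs
import HarnessLib

/-!
# Crux `BeyondCarrierDepthX10b` (stmt-BirchSwinnertonDyer-23055, `route-BirchSwinnertonDyer-PrintX10b`
# rev 18, rank 301): the RESIDUAL stub `stub_beyondCarrier_divisibleClassNumber_of_twins` of the
# registered birth skeleton v2 (BC3, plan g5 2026-08-27T23:19Z) — the `3 ∣ h_K` Heegner frames — as
# KERNEL GLUE from the two `p = 3` twins A₃ (Howard containment, ANY class number) and B₃ (the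
# two-sided IMC∘BDP link granted the containment, ANY class number), modulo the named facts
# `h331` / `hChaL` / `hKo` (turnkey T-A of the PrintX10b pen, 2026-08-27T23:24:35Z)

HONEST FRAMING (cell `run/shared/lean/pub/bsd-print-x9/`, D-0131 print tier; typer seat ty3 serving the
pen's turnkey T-A as the only seated hand — hence the file lives in the cell's typer tree
`Rank1Residual/X10/`, not under `BirchSwinnertonDyer/Theorems/` (prover-only, D-0016); the proof is
attached as evidence on item 23055): THEOREMS ONLY, nothing booked, nothing closed. The crux
`BeyondCarrierDepthX10b` is NOT closed by this file: its two OPEN inputs are exactly the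
hypotheses `hA` (= registered stub `stub_howardContainmentAnyClassNumberX10b`, A₃) and `hB`
(= registered stub `stub_twoSidedLinkAnyClassNumberX10b`, B₃), both BEYOND PRINT at `p = 3`
(cell DOSSIER §41.12–41.13: every any-`h_K` INTEGRAL containment is printed only at `p ≥ 5` /
`p ∤ 6N` — Burungale–Castella–Kim 2021 Thm. 3.1, Howard 2007 §3.3, Fouquet 2013; the torsion-layer
device and the RATIONAL divisibility are printed at `p ∤ 2N` in Castella–Grossi–Lee–Skinner 2022
Thm. 4.1.1 / 4.1.2, the integral part is not). What this file proves is the LINE OF RECORD of the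
skeleton: «X10b residual (`3 ∣ h_K` frames) ⟸ A₃ ∧ B₃ modulo h331 / hChaL / hKo», by name, in the
kernel. «beyond-print theorem»: NO (conditional glue; open inputs A₃, B₃ + cite-only h331/hChaL/hKo).
BSD is not proved by any of this.

WHAT.
* `indexIdentityAt_of_heegnerPoint_of_twins_of_thm331` — the Heegner-index identity over `K`
  (`X11b.IndexIdentityAt W 3 K P`: `2·ord_3 ∏ c_ℓ(E) + ord_3 #Ш(E/K) = 2·ord_3 [E(K):ℤP]`) at a
  Manin-unit Heegner datum of a non-CM X10b pair over a Heegner field with `3` split, `d_K` odd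
  `< −4`, Heegner point of infinite order — with NO class-number hypothesis: the twin of p4's
  `Rank1Residual.X10.indexIdentityAt_of_heegnerPoint_of_cor46_of_thm331_of_not_surj`
  (`Theorems/PrintX10bHeegnerDivisibilityHowardFrames.lean` §1) in which the two use-sites of
  `3 ∤ h_K` — Howard's containment (there from Mastella–Zerman Cor. 4.6, `h46`) and the two-sided
  link (there from the Yan–Zhu/BCS/CGLS composite, `hYZ`) — are fed instead by the any-class-number
  twins `hA` / `hB`; everything else (Kolyvagin rank one + finiteness `hKo`, (irr_K) by Matar–Nekovář
  Prop. 5.26 (2) — a tree theorem —, JSW Thm. 3.3.1 control `h331`, the all-split bookkeeping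
  `X11b.indexIdentityAt_of_onTreeGoodLinks_of_allSplit`) VERBATIM.
* `stub_beyondCarrier_divisibleClassNumber_of_twins_of_namedFacts (h331) (hChaL) (hKo) : A₃ → B₃ → s2`
  — the registered stub BY SIGNATURE (A₃ / B₃ / s2 = the statements of
  `stub_howardContainmentAnyClassNumberX10b` / `stub_twoSidedLinkAnyClassNumberX10b` / the conclusion
  of `stub_beyondCarrier_divisibleClassNumber_of_twins` in the registered skeleton, VERBATIM): on every
  rev-3b X10b Heegner frame (`d_K ≡ 1 (mod 8)`, `N_E` and `3` split, Manin-good, `y_K` of infinite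
  order) WITH `3 ∣ h_K`, for every beyond-carrier depth `s ≤ ord_3 ∏ c_q`, every derived Heegner point
  on Kolyvagin primes of index `≥ s` is `3^s`-divisible — the twin of p4's
  `Rank1Residual.heegnerDivisibilityX10b_coprimeFrames_of_namedFacts` (ibid. §2: Cha's LOWER half
  `hChaL` against the identity above; the frame binder `3 ∣ h_K` and the beyond-carrier clause are
  simply not used), with Shimura reciprocity at conductor `1` DISCHARGED by the tree theorem
  `heegnerPointOfConductor_one_galoisConj_holds` (as in p581299
  `stub_beyondCarrier_coprimeClassNumber_of_namedFacts`, `Theorems/PrintX10bBeyondCarrierCoprimeFrames.lean`).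
With p581299 (the `3 ∤ h_K` frames) and the skeleton's case split `BeyondCarrierDepthX10b_of`, the crux
is thereby reduced IN THE KERNEL to A₃ ∧ B₃ modulo the cell's named facts.

References: [Cha2005] Thm. 21, Rmk. 25; [JetchevSkinnerWan2017] Thm. 3.3.1; [Kolyvagin1990] Thm. A;
[MatarNekovar2019] Prop. 5.26 (2); [GrossLMS1991] §2 Conj. (2.2); [McCallumLMS1991] §5;
[Darmon2004] Thm. 3.7; [Howard2004HeegnerKolyvagin] Thm. B; [CastellaGrossiLeeSkinner2022] Thm. 4.1.1;
registered skeleton `run/shared/lean/pub/bsd-print-x9/plan/skeletons/BeyondCarrierDepthX10b_birth_v2.lean`;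
route file `Theses/PrintX10b.lean` (rev 18, items 21340 / 23055).
-/

-- the REGISTERED stub namespace `Summit.BirchSwinnertonDyer.BirchSwinnertonDyer.Cruxes.…` repeats the summit name
set_option linter.dupNamespace false
set_option autoImplicit false

noncomputable section

open scoped Classical MatrixGroups ModularForm

open CongruenceSubgroup WeierstrassCurve NumberField IsDedekindDomain
  Literature.NumberTheory.EllipticCurves Literature.NumberTheory.EllipticCurves.ModularForms
  Literature.NumberTheory.EllipticCurves.JetchevSkinnerWan2017
  Literature.NumberTheory.EllipticCurves.YanZhu2026
  Summit.BirchSwinnertonDyer.BirchSwinnertonDyer.Theorems.Rank1ResidualX1Defs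
  Summit.BirchSwinnertonDyer.Rank1Residual
  Summit.BirchSwinnertonDyer.Rank1Residual.X11b.Three.Koly
  Summit.BirchSwinnertonDyer.Rank1Residual.X11b.KolyvaginBottom
  Summit.BirchSwinnertonDyer.BirchSwinnertonDyer.Rank1Residual

open Literature.NumberTheory.EllipticCurves.Rank1Residual (ClassX10 Surj)

namespace Summit.BirchSwinnertonDyer.BirchSwinnertonDyer.Cruxes.BeyondCarrierDepthX10b.HowardFrames

/-! ### §1 The Heegner-index identity over `K` at `p = 3`, X10b, ANY class number — from the twins -/

/-- **The Heegner-index identity over `K` at a Manin-unit Heegner datum of a NON-CM X10b pair (`p = 3`,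
`E[3]` irreducible, `ρ̄_{E,3}` not onto) over a Heegner field with `3` split, `d_K` odd `< −4`, whose
Heegner point `P` has INFINITE ORDER — with NO class-number hypothesis**, granted the two `p = 3`
twins: Howard's containment for any class number (`hA`, = registered stub A₃ of crux 23055) and the
two-sided IMC∘BDP link granted the containment, any class number (`hB`, = registered stub B₃).
Rank one and finiteness over `K` by Kolyvagin (`hKo`), (irr_K) by the Matar–Nekovář theorem, the
anticyclotomic control by JSW Thm. 3.3.1 (`h331`). The twin of
`Rank1Residual.X10.indexIdentityAt_of_heegnerPoint_of_cor46_of_thm331_of_not_surj` with its two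
`3 ∤ h_K` use-sites (containment, link) replaced by `hA` / `hB` and the binder `3 ∤ h_K` deleted.
[cite: JetchevSkinnerWan2017, Thm. 3.3.1, §7.3.1 (eq:tamK)] [cite: Kolyvagin1990, Thm. A]
[cite: MatarNekovar2019, Prop. 5.26 (2)] [cite: GrossLMS1991, §2 Conj. (2.2)]
[cite: Howard2004HeegnerKolyvagin, Thm. B (the containment, there under p ∤ h_K)] -/
theorem indexIdentityAt_of_heegnerPoint_of_twins_of_thm331
    (hA : ∀ (W : WeierstrassCurve ℚ) [W.IsElliptic] [W.IsGloballyMinimal] (p : ℕ) [Fact p.Prime]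
    [NeZero (W.conductorNorm ℤ)] (K : Type) [Field K] [NumberField K],
    Literature.NumberTheory.EllipticCurves.Rank1Residual.ClassX10 W p →
    ¬ Literature.NumberTheory.EllipticCurves.Rank1Residual.Surj W 3 → ¬ W.HasCM →
    Literature.NumberTheory.EllipticCurves.IsImaginaryQuadratic K → NumberField.discr K ≠ -3 →
    NumberField.discr K ≠ -4 →
    Literature.NumberTheory.EllipticCurves.SatisfiesHeegnerHypothesis (W.conductorNorm ℤ) K →
    Literature.NumberTheory.EllipticCurves.SatisfiesHeegnerHypothesis p K →
    ∀ (κ : Literature.NumberTheory.EllipticCurves.ZpExtension K p), κ.IsAnticyclotomic →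
    ∀ (γ : Field.absoluteGaloisGroup K), κ.IsTopGenerator γ →
    ∀ (Dt : Literature.NumberTheory.EllipticCurves.ModularForms.ModularParametrizationData W
        (W.conductorNorm ℤ))
      (H : Literature.NumberTheory.EllipticCurves.HeegnerDatum (W.conductorNorm ℤ) (NumberField.discr K))
      (ιC : K →+* ℂ),
    ∃ (jbar : AlgebraicClosure K →+* ℂ) (D : (W.baseChange K).LambdaAdicSelmerData κ γ)
      (F : Literature.NumberTheory.EllipticCurves.HeegnerFamily (W.conductorNorm ℤ) W K κ jbar)
      (X : (W.baseChange K).SelmerDualData κ γ),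
      Literature.NumberTheory.EllipticCurves.heegnerCharIdeal D F ^ 2 ≤
        Literature.NumberTheory.EllipticCurves.Module.charIdeal
          (Literature.NumberTheory.EllipticCurves.IwasawaAlgebra p)
          (Submodule.torsion (Literature.NumberTheory.EllipticCurves.IwasawaAlgebra p) X.X))
    (hB : ∀ (W : WeierstrassCurve ℚ) [W.IsElliptic] [W.IsGloballyMinimal] (p : ℕ) [Fact p.Prime]
    [NeZero (W.conductorNorm ℤ)] (K : Type) [Field K] [NumberField K],
    Literature.NumberTheory.EllipticCurves.Rank1Residual.ClassX10 W p →
    ¬ Literature.NumberTheory.EllipticCurves.Rank1Residual.Surj W 3 → ¬ W.HasCM →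
    Literature.NumberTheory.EllipticCurves.IsImaginaryQuadratic K → Odd (NumberField.discr K) →
    NumberField.discr K ≠ -3 →
    Literature.NumberTheory.EllipticCurves.SatisfiesHeegnerHypothesis (W.conductorNorm ℤ) K →
    Literature.NumberTheory.EllipticCurves.SatisfiesHeegnerHypothesis p K →
    (W.baseChange K).HasIrreducibleModPGaloisRep p →
    ∀ (ι : K →+* ℚ_[p]) (κ : Literature.NumberTheory.EllipticCurves.ZpExtension K p), κ.IsAnticyclotomic →
    ∀ (γ : Field.absoluteGaloisGroup K) [Fact (κ.IsTopGenerator γ)]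
      (Dt : Literature.NumberTheory.EllipticCurves.ModularForms.ModularParametrizationData W
        (W.conductorNorm ℤ)), ¬ (p : ℤ) ∣ Dt.c →
    ∀ (H : Literature.NumberTheory.EllipticCurves.HeegnerDatum (W.conductorNorm ℤ) (NumberField.discr K))
      (ιC : K →+* ℂ) (P : (W.baseChange K).toAffine.Point),
      WeierstrassCurve.Affine.Point.map ιC.toRatAlgHom P =
        Literature.NumberTheory.EllipticCurves.ModularForms.heegnerPointComplex Dt H →
      (W.baseChange K).mordellWeilRank = 1 →
      Finite (AddCommGroup.primaryComponent (W.baseChange K).sha p) → ¬ IsOfFinAddOrder P →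
      (∃ (jbar : AlgebraicClosure K →+* ℂ) (D : (W.baseChange K).LambdaAdicSelmerData κ γ)
        (F : Literature.NumberTheory.EllipticCurves.HeegnerFamily (W.conductorNorm ℤ) W K κ jbar)
        (X : (W.baseChange K).SelmerDualData κ γ),
        Literature.NumberTheory.EllipticCurves.heegnerCharIdeal D F ^ 2 ≤
          Literature.NumberTheory.EllipticCurves.Module.charIdeal
            (Literature.NumberTheory.EllipticCurves.IwasawaAlgebra p)
            (Submodule.torsion (Literature.NumberTheory.EllipticCurves.IwasawaAlgebra p) X.X)) →
      Summit.BirchSwinnertonDyer.Rank1Residual.X11b.IMCWaldspurgerOnTreeGoodAt p κ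
        (Summit.BirchSwinnertonDyer.Rank1Residual.X11b.inducedPlace ι) γ ι P)
    (h331 : thm331_anticyclotomicControl)
    (W : WeierstrassCurve ℚ) [W.IsElliptic] [W.IsGloballyMinimal] [NeZero (W.conductorNorm ℤ)]
    (p : ℕ) [Fact p.Prime] (hX : ClassX10 W p) (hns : ¬ Surj W 3) (hcm : ¬ W.HasCM)
    (K : Type) [Field K] [NumberField K] (hKo : kolyvagin (W.conductorNorm ℤ) W K)
    (hK : IsImaginaryQuadratic K) (hodd : Odd (NumberField.discr K)) (hlt : NumberField.discr K < -4)
    (hHN : SatisfiesHeegnerHypothesis (W.conductorNorm ℤ) K) (hHp : SatisfiesHeegnerHypothesis p K)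
    (Dt : ModularParametrizationData W (W.conductorNorm ℤ))
    (H : HeegnerDatum (W.conductorNorm ℤ) (NumberField.discr K)) (ιC : K →+* ℂ)
    (P : (W.baseChange K).toAffine.Point)
    (hP : WeierstrassCurve.Affine.Point.map ιC.toRatAlgHom P = heegnerPointComplex Dt H)
    (hPinf : ¬ IsOfFinAddOrder P) (hc : ¬ (p : ℤ) ∣ Dt.c) : X11b.IndexIdentityAt W p K P := by
  obtain ⟨hp3, hord, hirr, -⟩ := id hX
  subst hp3
  have hpP : (3 : ℕ).Prime := Fact.out
  have hp2 : (3 : ℕ) ≠ 2 := by norm_num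
  have h3 : NumberField.discr K ≠ -3 := by omega
  have h4 : NumberField.discr K ≠ -4 := by omega
  -- rank one and finiteness over `K` (Kolyvagin, from the non-torsion Heegner point)
  obtain ⟨hrk, hshaK⟩ := hKo hK hHN ⟨Dt, H, ιC, hP⟩ hPinf
  haveI : Finite (W.baseChange K).sha := hshaK
  have hfinp : Finite (AddCommGroup.primaryComponent (W.baseChange K).sha 3) :=
    Finite.of_injective _ Subtype.val_injective
  -- (irr_K) at this field (Matar–Nekovář Prop. 5.26 (2), a tree theorem)
  have hirrK : (W.baseChange K).HasIrreducibleModPGaloisRep 3 :=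
    MatarNekovar2019.prop526_hasIrreducibleModPGaloisRep_baseChange_holds W K hK.1
      (Literature.SatisfiesHeegnerHypothesis.coprime_discr hK.1 hHN) 3 hp2 hirr
  -- the anticyclotomic datum and the embedding at a prime above `3`
  obtain ⟨κ, γ, 𝔭, hκ, hγ, h𝔭⟩ := X11b.exists_anticyclotomic_generator_prime (p := 3) hK
  haveI : Fact (κ.IsTopGenerator γ) := ⟨hγ⟩
  have hsplit : X11b.SplitsIn K 3 := hHp 3 Fact.out (dvd_refl 3)
  obtain ⟨he, hf⟩ := X11b.degreeOne_of_splitsIn hK.1 hsplit h𝔭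
  set ι : K →+* ℚ_[3] := X11b.embAt K 3 𝔭 h𝔭 he hf with hι
  have hCTL : X11b.ControlOnTreeGoodAt 3 κ (X11b.inducedPlace ι) γ ι P :=
    X11b.controlOnTreeGoodAt_of_thm331_of_inducedPlace h331 le_rfl hord.1 hK hHp rfl hHN hirrK ι
      κ hκ γ hrk hfinp P hPinf
  -- Howard's containment at the frame, ANY class number (twin A₃)
  have hHow := hA W 3 K hX hns hcm hK h3 h4 hHN hHp κ hκ γ hγ Dt H ιC
  -- the two-sided link granted the containment, ANY class number (twin B₃)
  have hIW : X11b.IMCWaldspurgerOnTreeGoodAt 3 κ (X11b.inducedPlace ι) γ ι P :=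
    hB W 3 K hX hns hcm hK hodd h3 hHN hHp hirrK ι κ hκ γ Dt hc H ιC P hP hrk hfinp hPinf hHow
  exact X11b.indexIdentityAt_of_onTreeGoodLinks_of_allSplit hK rfl hHN hIW hCTL

/-! ### §2 The registered residual stub `stub_beyondCarrier_divisibleClassNumber_of_twins`, from named facts -/

/-- **Stub `stub_beyondCarrier_divisibleClassNumber_of_twins` of crux `BeyondCarrierDepthX10b` (item
23055), registered signature VERBATIM, modulo THREE named facts** (`h331` JSW Thm. 3.3.1, `hChaL` Cha
Rmk. 25 lower half, `hKo` Kolyvagin Thm. A; Shimura reciprocity at conductor `1` is supplied by the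
tree theorem `heegnerPointOfConductor_one_galoisConj_holds`): GRANTED the `p = 3` twins A₃ (Howard
containment, any class number) and B₃ (two-sided link granted the containment, any class number), on
every rev-3b X10b Heegner frame (`p = 3`, `E[3]` irreducible, `ρ̄_{E,3}` not onto, non-CM, `r_an = 1`;
`d_K ≡ 1 (mod 8)`, `N_E` and `3` split, Manin-good, `y_K` of infinite order) WITH `3 ∣ h_K`, for every
beyond-carrier depth `s ≤ ord_3 ∏ c_q(E)`, every derived Heegner point `P_n` on Kolyvagin primes of
index `≥ s` is `3^s`-divisible in `E(K[n])` (bound `B = 4`). Proof = the twin of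
`Rank1Residual.heegnerDivisibilityX10b_coprimeFrames_of_namedFacts`: a non-divisible `P_n` at depth
`s ≤ t` is a level-`s` certificate ⇒ `2(M₀ − s + 1) ≤ ord_3 #Ш(E/K)` (Cha's lower half), against the
identity `ord_3 #Ш(E/K) = 2M₀ − 2t` of §1; the frame binder `3 ∣ h_K` and the beyond-carrier clause
are not used. NO Jetchev, NO Kolyvagin conjecture, NO carrier-depth stub, NO class-number hypothesis
beyond the (unused) binder.
[cite: Cha2005, Thm. 21 and Rmk. 25] [cite: JetchevSkinnerWan2017, Thm. 3.3.1] [cite: Kolyvagin1990, Thm. A]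
[cite: McCallumLMS1991, §5 (Lemma 5.1)] [cite: Darmon2004, Thm. 3.7] [cite: MatarNekovar2019, Thm. 0.7, §0.9, §0.11] -/
theorem stub_beyondCarrier_divisibleClassNumber_of_twins_of_namedFacts
    (h331 : thm331_anticyclotomicControl)
    (hChaL : Cha2005.rmk25_pow_dvd_card_sha_primary_of_certificate)
    (hKo : ∀ (N : ℕ) [NeZero N] (W : WeierstrassCurve ℚ) (K : Type) [Field K] [NumberField K],
      kolyvagin N W K) :
    (∀ (W : WeierstrassCurve ℚ) [W.IsElliptic] [W.IsGloballyMinimal] (p : ℕ) [Fact p.Prime]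
    [NeZero (W.conductorNorm ℤ)] (K : Type) [Field K] [NumberField K],
    Literature.NumberTheory.EllipticCurves.Rank1Residual.ClassX10 W p →
    ¬ Literature.NumberTheory.EllipticCurves.Rank1Residual.Surj W 3 → ¬ W.HasCM →
    Literature.NumberTheory.EllipticCurves.IsImaginaryQuadratic K → NumberField.discr K ≠ -3 →
    NumberField.discr K ≠ -4 →
    Literature.NumberTheory.EllipticCurves.SatisfiesHeegnerHypothesis (W.conductorNorm ℤ) K →
    Literature.NumberTheory.EllipticCurves.SatisfiesHeegnerHypothesis p K →
    ∀ (κ : Literature.NumberTheory.EllipticCurves.ZpExtension K p), κ.IsAnticyclotomic →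
    ∀ (γ : Field.absoluteGaloisGroup K), κ.IsTopGenerator γ →
    ∀ (Dt : Literature.NumberTheory.EllipticCurves.ModularForms.ModularParametrizationData W
        (W.conductorNorm ℤ))
      (H : Literature.NumberTheory.EllipticCurves.HeegnerDatum (W.conductorNorm ℤ) (NumberField.discr K))
      (ιC : K →+* ℂ),
    ∃ (jbar : AlgebraicClosure K →+* ℂ) (D : (W.baseChange K).LambdaAdicSelmerData κ γ)
      (F : Literature.NumberTheory.EllipticCurves.HeegnerFamily (W.conductorNorm ℤ) W K κ jbar)
      (X : (W.baseChange K).SelmerDualData κ γ),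
      Literature.NumberTheory.EllipticCurves.heegnerCharIdeal D F ^ 2 ≤
        Literature.NumberTheory.EllipticCurves.Module.charIdeal
          (Literature.NumberTheory.EllipticCurves.IwasawaAlgebra p)
          (Submodule.torsion (Literature.NumberTheory.EllipticCurves.IwasawaAlgebra p) X.X)) →
    (∀ (W : WeierstrassCurve ℚ) [W.IsElliptic] [W.IsGloballyMinimal] (p : ℕ) [Fact p.Prime]
    [NeZero (W.conductorNorm ℤ)] (K : Type) [Field K] [NumberField K],
    Literature.NumberTheory.EllipticCurves.Rank1Residual.ClassX10 W p →
    ¬ Literature.NumberTheory.EllipticCurves.Rank1Residual.Surj W 3 → ¬ W.HasCM →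
    Literature.NumberTheory.EllipticCurves.IsImaginaryQuadratic K → Odd (NumberField.discr K) →
    NumberField.discr K ≠ -3 →
    Literature.NumberTheory.EllipticCurves.SatisfiesHeegnerHypothesis (W.conductorNorm ℤ) K →
    Literature.NumberTheory.EllipticCurves.SatisfiesHeegnerHypothesis p K →
    (W.baseChange K).HasIrreducibleModPGaloisRep p →
    ∀ (ι : K →+* ℚ_[p]) (κ : Literature.NumberTheory.EllipticCurves.ZpExtension K p), κ.IsAnticyclotomic →
    ∀ (γ : Field.absoluteGaloisGroup K) [Fact (κ.IsTopGenerator γ)]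
      (Dt : Literature.NumberTheory.EllipticCurves.ModularForms.ModularParametrizationData W
        (W.conductorNorm ℤ)), ¬ (p : ℤ) ∣ Dt.c →
    ∀ (H : Literature.NumberTheory.EllipticCurves.HeegnerDatum (W.conductorNorm ℤ) (NumberField.discr K))
      (ιC : K →+* ℂ) (P : (W.baseChange K).toAffine.Point),
      WeierstrassCurve.Affine.Point.map ιC.toRatAlgHom P =
        Literature.NumberTheory.EllipticCurves.ModularForms.heegnerPointComplex Dt H →
      (W.baseChange K).mordellWeilRank = 1 →
      Finite (AddCommGroup.primaryComponent (W.baseChange K).sha p) → ¬ IsOfFinAddOrder P →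
      (∃ (jbar : AlgebraicClosure K →+* ℂ) (D : (W.baseChange K).LambdaAdicSelmerData κ γ)
        (F : Literature.NumberTheory.EllipticCurves.HeegnerFamily (W.conductorNorm ℤ) W K κ jbar)
        (X : (W.baseChange K).SelmerDualData κ γ),
        Literature.NumberTheory.EllipticCurves.heegnerCharIdeal D F ^ 2 ≤
          Literature.NumberTheory.EllipticCurves.Module.charIdeal
            (Literature.NumberTheory.EllipticCurves.IwasawaAlgebra p)
            (Submodule.torsion (Literature.NumberTheory.EllipticCurves.IwasawaAlgebra p) X.X)) →
      Summit.BirchSwinnertonDyer.Rank1Residual.X11b.IMCWaldspurgerOnTreeGoodAt p κ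
        (Summit.BirchSwinnertonDyer.Rank1Residual.X11b.inducedPlace ι) γ ι P) →
    ∀ (W : WeierstrassCurve ℚ) [W.IsElliptic] [W.IsGloballyMinimal] [NeZero (W.conductorNorm ℤ)] (p : ℕ) [Fact p.Prime], Literature.NumberTheory.EllipticCurves.Rank1Residual.ClassX10 W p → ¬ Literature.NumberTheory.EllipticCurves.Rank1Residual.Surj W 3 → ¬ W.HasCM → W.analyticRank = 1 → ∃ B : ℕ, ∀ (K : Type) [Field K] [NumberField K] (Dt : Literature.NumberTheory.EllipticCurves.ModularForms.ModularParametrizationData W (W.conductorNorm ℤ)) (β : ℤ) (ι : K →+* ℂ), Literature.NumberTheory.EllipticCurves.IsImaginaryQuadratic K → B < (NumberField.discr K).natAbs → NumberField.discr K % 8 = 1 → Literature.NumberTheory.EllipticCurves.SatisfiesHeegnerHypothesis (W.conductorNorm ℤ) K → Literature.NumberTheory.EllipticCurves.SatisfiesHeegnerHypothesis p K → p ∣ NumberField.classNumber K → (4 * (W.conductorNorm ℤ : ℤ)) ∣ β ^ 2 - NumberField.discr K → ¬ (p : ℤ) ∣ Dt.c → ∀ (d₁ : Literature.NumberTheory.EllipticCurves.KolyvaginHeegnerData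 Dt β ι 1), ¬ IsOfFinAddOrder d₁.derivedPoint → ∀ (s : ℕ), (∀ (q : ℕ) [Fact q.Prime], q ∣ W.conductorNorm ℤ → padicValNat p ((W.baseChange ℚ_[q]).localTamagawaNumber ℤ_[q]) < s) → s ≤ padicValNat p W.tamagawaProduct → ∀ (n : ℕ) (d : Literature.NumberTheory.EllipticCurves.KolyvaginHeegnerData Dt β ι n), Squarefree n → (∀ ℓ ∈ n.primeFactors, Literature.NumberTheory.EllipticCurves.Zhang2014.IsKolyvaginPrime (W.conductorNorm ℤ) W K p ℓ ∧ s ≤ Literature.NumberTheory.EllipticCurves.Zhang2014.kolyvaginIndex W p ℓ) → ∃ Q : (W.baseChange (Literature.NumberTheory.EllipticCurves.ringClassField K ι n)).toAffine.Point, ((p ^ s : ℕ) : ℤ) • Q = d.derivedPoint := by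
  intro hA hB W _ _ _ p _ hX hns hcm _
  obtain ⟨hp3, hordW, hirr, -⟩ := id hX
  subst hp3
  refine ⟨4, ?_⟩
  intro K _ _ Dt β ι hK hBK hd8 hHN hHp _ hβ hc d₁ hd₁ s _ hs n d hn hℓ
  -- Shimura reciprocity at conductor `1`: a tree THEOREM (Darmon Thm. 3.7)
  have hrec : ∀ (N : ℕ) [NeZero N] (W : WeierstrassCurve ℚ) (K : Type) [Field K] [NumberField K],
      heegnerPointOfConductor_one_galoisConj N W K :=
    fun N _ W K _ _ ↦ heegnerPointOfConductor_one_galoisConj_holds N W K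
  have hodd : Odd (NumberField.discr K) := Int.odd_iff.mpr (by omega)
  have hpP : (3 : ℕ).Prime := Fact.out
  have hp2 : (3 : ℕ) ≠ 2 := by norm_num
  have hneg : NumberField.discr K < 0 := IsImaginaryQuadratic.discr_neg hK
  have hlt : NumberField.discr K < -4 := by omega
  have h3 : NumberField.discr K ≠ -3 := by omega
  have h4 : NumberField.discr K ≠ -4 := by omega
  have hpd : ¬ ((3 : ℕ) : ℤ) ∣ NumberField.discr K :=
    Literature.SatisfiesHeegnerHypothesis.not_dvd_discr hK.1 hHp hpP (dvd_refl 3)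
  have hpN : ¬ 3 ∣ W.conductorNorm ℤ := fun h ↦
    (W.dvd_conductorNorm_iff_not_hasGoodReductionAtPrime 3).mp h hordW.1
  have hpN2 : ¬ 3 ^ 2 ∣ W.conductorNorm ℤ := fun h ↦ hpN (dvd_trans (dvd_pow_self 3 two_ne_zero) h)
  -- depth `0` is trivial
  rcases Nat.eq_zero_or_pos s with rfl | hs1
  · exact ⟨d.derivedPoint, by rw [pow_zero, Nat.cast_one, one_zsmul]⟩
  -- the oriented Heegner datum of the frame and THE Heegner point `y_K ∈ E(K)`
  obtain ⟨H, hHβ⟩ := exists_heegnerDatum (W.conductorNorm ℤ) hneg hβ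
  obtain ⟨P, hP⟩ := heegnerPointComplex_mem_range_map_holds (W.conductorNorm ℤ) W K hK hHN Dt H ι
  have hPd : d₁.toGeomPoints d₁.derivedPoint = toGeomPoints (W.baseChange K) P :=
    toGeomPoints_derivedPoint_one_eq (hrec _ W K) hK hHN hP d₁ hHβ
  have hPinf : ¬ IsOfFinAddOrder P := fun hfin ↦
    hd₁ ((isOfFinAddOrder_derivedPoint_one_iff (hrec _ W K) hK hHN hP d₁ hHβ).mpr hfin)
  -- the identity over `K` at this frame, ANY class number (§1, from the twins)
  have hid := indexIdentityAt_of_heegnerPoint_of_twins_of_thm331 hA hB h331 W 3 hX hns hcm K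
    (hKo _ W K) hK hodd hlt hHN hHp Dt H ι P hP hPinf hc
  -- rank one and finiteness over `K` (Kolyvagin), no `p`-torsion (irreducibility)
  obtain ⟨hrank, hshaK⟩ := hKo (W.conductorNorm ℤ) W K hK hHN ⟨Dt, H, ι, hP⟩ hPinf
  haveI : Finite (W.baseChange K).sha := hshaK
  haveI hfinp : Finite (AddCommGroup.primaryComponent (W.baseChange K).sha 3) :=
    Finite.of_injective _ Subtype.val_injective
  have hbot := torsionBy_eq_bot_of_isImaginaryQuadratic_of_hasIrreducibleModPGaloisRep W K hK hpP hirr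
  have hiv : ∀ x : (W.baseChange K).toAffine.Point, 3 • x = 0 → x = 0 := fun x hx ↦ by
    have hmem : x ∈ AddSubgroup.torsionBy (W.baseChange K).toAffine.Point (((3 : ℕ) : ℕ) : ℤ) := by
      rw [mem_torsionBy_iff, natCast_zsmul]
      exact hx
    rw [hbot] at hmem
    exact hmem
  -- the exponent `p^{M₀} ∥ y_K` in `E(K)` and `ord_p [E(K):ℤy_K] = M₀` (McCallum Lemma 5.1)
  haveI : Module.Finite ℤ (W.baseChange K).toAffine.Point := (W.baseChange K).module_finite_point_holds
  obtain ⟨M₀, x₀, hx₀, hmax⟩ := exists_pow_smul_eq_and_forall_ne hPinf (p := 3) hpP.two_le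
  have hdiv : ∃ Q : (W.baseChange K).toAffine.Point, ((3 ^ M₀ : ℕ) : ℤ) • Q = P :=
    ⟨x₀, by rw [natCast_zsmul]; exact hx₀⟩
  have hndiv : ¬ ∃ Q : (W.baseChange K).toAffine.Point, ((3 ^ (M₀ + 1) : ℕ) : ℤ) • Q = P := by
    rintro ⟨Q, hQ⟩
    exact hmax Q (by rw [← natCast_zsmul]; exact hQ)
  haveI : Finite (AddCommGroup.torsion (W.baseChange K).toAffine.Point) :=
    WeierstrassCurve.finite_torsion_point (W := W.baseChange K)
  obtain ⟨c, Q, hcQ, hcker⟩ := X11b.RankOne.exists_coord_of_mordellWeilRank_eq_one (W.baseChange K) hrank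
  have hidx : padicValNat 3 (AddSubgroup.zmultiples P).index = M₀ :=
    padicValNat_index_zmultiples_eq_of_divisibility c Q hcQ hcker hiv P hdiv hndiv
  -- suppose `P_n ∉ 3^s E(K_n)`: a level-`s` certificate; Cha's LOWER half bounds `#Ш` from below
  by_contra hQ
  have hcert := hChaL W hcm K hK h3 h4 hHN 3 hp2 hpd hpN2 hirr Dt β ι d₁ P hPd hPinf M₀
    hdiv hndiv n (s - 1) d hn
    (fun ℓ hℓ' ↦ ⟨(hℓ ℓ hℓ').1, by have := (hℓ ℓ hℓ').2; omega⟩)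
    (by rw [Nat.sub_add_cancel hs1]; exact hQ)
  have hle : 2 * (M₀ - (s - 1)) ≤
      padicValNat 3 (Nat.card (AddCommGroup.primaryComponent (W.baseChange K).sha 3)) :=
    (padicValNat_dvd_iff_le Nat.card_pos.ne').mp hcert
  rw [padicValNat_card_addPrimaryComponent (A := (W.baseChange K).sha) 3] at hle
  -- the identity: `2t + ord_p #Ш(E/K) = 2M₀`
  unfold X11b.IndexIdentityAt at hid
  rw [WeierstrassCurve.shaOrder, hidx] at hid
  omega

end Summit.BirchSwinnertonDyer.BirchSwinnertonDyer.Cruxes.BeyondCarrierDepthX10b.HowardFrames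

end
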